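import Summits.CriticalPhenomena.PercolationContinuityZ3.Theorems.SahiMasterFamilySandwich

/-!
# Structure theory of the zero-flag class, I: forced-open hulls, splitting, and factorisations

Unit `prim-master-conj` (crux anchor stmt-CriticalPhenomena-4575), first file of the all-order programme STRUCTURE-THEORY.md
(gen 6).  Configurations are `ω : Set ι`, events are `Set (Set ι)`; all events of interest are increasing.

* `hull S D = {ω | ω ∪ S ∈ D}` — the forced-open hull (the tree's inline `{ω | ω ∪ ↑S ∈ G}` of `SahiMasterFamilySandwich`),
  with its algebra: `hull_hull`, `hull_inter`, `hull_mono_left/right`, `esupp_hull_subset`, `hull_eq_self_of_disjoint`,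
  `hull_eq_univ_of_esupp_subset`.
* The **splitting lemma** `mem_of_union_mem_of_noEdge`: if no coordinate of `P` is a "substitute" of a coordinate of `Q` for the
  increasing event `W` (`insert e ω ∈ W → insert f ω ∈ W → ω ∈ W`), then `ω ∪ P ∈ W` and `ω ∪ Q ∈ W` force `ω ∈ W`
  (two finite inductions); and `noEdge_of_inter`: a factorisation `W = U ∩ V` over disjoint supports has no substitutes across.
* Products of increasing events with pairwise disjoint supports ("frames"): `subset_esupp_biInter_of_frame` (each factor's support
  lies in the support of the product), `hull_biInter_of_frame` (saturating the other blocks recovers a factor), and the rigidity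
  statement `compl_notMem_of_two_factorisations`: if `W` is such a product in two ways and two blocks `esupp (A a)`, `esupp (B b)`
  of the two factorisations meet in `P ≠ ∅`, then the configuration "everything but `P`" is not in `W` — the input of the
  canonicity of frames (STRUCTURE-THEORY §3.3).
Pure combinatorics of up-sets; axioms standard. [this work]
-/

noncomputable section

open scoped Classical

namespace Summit.CriticalPhenomena.PercolationContinuityZ3.Theorems

open Finset Function
open Literature.Probability.LatticeModels.Kahn2022 (Affects)

variable {ι : Type*} [Fintype ι]

/-! ### The forced-open hull -/

/-- **Forced-open hull**: `hull S D = {ω | ω ∪ S ∈ D}`, the configurations that enter `D` once every coordinate of `S` is opened.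
[this work] -/
def hull (S : Set ι) (D : Set (Set ι)) : Set (Set ι) := {ω | ω ∪ S ∈ D}

omit [Fintype ι] in
/-- Membership in the hull. [this work] -/
@[simp] theorem mem_hull {S : Set ι} {D : Set (Set ι)} {ω : Set ι} : ω ∈ hull S D ↔ ω ∪ S ∈ D := Iff.rfl

omit [Fintype ι] in
/-- The hull of an increasing event is increasing. [folklore] -/
theorem isUpperSet_hull {D : Set (Set ι)} (hD : IsUpperSet D) (S : Set ι) : IsUpperSet (hull S D) :=
  fun _ _ hle h => hD (Set.union_subset_union_left S hle) h

omit [Fintype ι] in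
/-- An increasing event lies in its hull. [folklore] -/
theorem subset_hull {D : Set (Set ι)} (hD : IsUpperSet D) (S : Set ι) : D ⊆ hull S D :=
  fun _ h => hD Set.subset_union_left h

omit [Fintype ι] in
/-- The hull over `∅` is the event. [folklore] -/
@[simp] theorem hull_empty (D : Set (Set ι)) : hull ∅ D = D := by
  ext ω; simp

omit [Fintype ι] in
/-- Hulls compose by union of the opened sets. [this work] -/
theorem hull_hull (S S' : Set ι) (D : Set (Set ι)) : hull S (hull S' D) = hull (S ∪ S') D := by
  ext ω; simp [Set.union_assoc]

omit [Fintype ι] in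
/-- The hull of an intersection. [this work] -/
theorem hull_inter (S : Set ι) (D D' : Set (Set ι)) : hull S (D ∩ D') = hull S D ∩ hull S D' := by
  ext ω; simp

omit [Fintype ι] in
/-- The hull is monotone in the event. [this work] -/
theorem hull_mono_right (S : Set ι) {D D' : Set (Set ι)} (h : D ⊆ D') : hull S D ⊆ hull S D' :=
  fun _ hω => h hω

omit [Fintype ι] in
/-- The hull of an increasing event is monotone in the opened set. [this work] -/
theorem hull_mono_left {D : Set (Set ι)} (hD : IsUpperSet D) {S S' : Set ι} (h : S ⊆ S') : hull S D ⊆ hull S' D :=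
  fun ω hω => hD (Set.union_subset_union_right ω h) hω

omit [Fintype ι] in
/-- No opened coordinate acts on the hull. [folklore] -/
theorem not_affects_hull (D : Set (Set ι)) {S : Set ι} {e : ι} (he : e ∈ S) : ¬ Affects (hull S D) e := by
  rintro ⟨ω, hω, heω⟩
  apply hω
  simp only [mem_hull] at heω ⊢
  rwa [Set.insert_union, Set.insert_eq_of_mem (Set.mem_union_right ω he)] at heω

/-- The essential support of a hull: inside that of the event and off the opened set. [this work] -/
theorem esupp_hull_subset {D : Set (Set ι)} (S : Finset ι) : esupp (hull ↑S D) ⊆ esupp D \ S := by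
  intro e he
  rw [mem_sdiff]
  have hA := mem_esupp.1 he
  refine ⟨?_, fun heS => not_affects_hull D (mem_coe.2 heS) hA⟩
  obtain ⟨ω, hω, heω⟩ := hA
  refine mem_esupp.2 ⟨ω ∪ ↑S, hω, ?_⟩
  simp only [mem_hull] at heω
  rwa [Set.insert_union] at heω

/-- An increasing event ignoring the opened coordinates is its own hull. [this work] -/
theorem hull_eq_self_of_disjoint {D : Set (Set ι)} (hD : IsUpperSet D) {S : Set ι} (h : Disjoint S ↑(esupp D)) :
    hull S D = D := by
  refine Set.Subset.antisymm (fun ω hω => ?_) (subset_hull hD S)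
  rw [mem_hull] at hω
  refine (mem_iff_of_inter_esupp_eq hD ?_).1 hω
  ext i
  simp only [Set.mem_inter_iff, Set.mem_union, mem_coe]
  constructor
  · rintro ⟨hi | hi, hiD⟩
    · exact ⟨hi, hiD⟩
    · exact absurd (mem_coe.2 hiD) (Set.disjoint_left.1 h hi)
  · rintro ⟨hi, hiD⟩
    exact ⟨Or.inl hi, hiD⟩

/-- Opening all acting coordinates of a nonempty increasing event gives everything. [this work] -/
theorem hull_eq_univ_of_esupp_subset {D : Set (Set ι)} (hD : IsUpperSet D) (hne : D.Nonempty) {S : Set ι}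
    (h : ↑(esupp D) ⊆ S) : hull S D = Set.univ :=
  Set.eq_univ_of_forall fun _ => mem_of_esupp_subset hD hne (h.trans Set.subset_union_right)

/-! ### Splitting along non-substitutable coordinates -/

omit [Fintype ι] in
/-- If opening `e` enters `W` from `ω`, and `e` has no substitute in `Q`, then no amount of opening `Q` enters `W` from `ω`.
[this work] -/
theorem union_notMem_of_noEdge {W : Set (Set ι)} (hW : IsUpperSet W) {e : ι} (Q : Finset ι)
    (hQ : ∀ f ∈ Q, ∀ ω : Set ι, insert e ω ∈ W → insert f ω ∈ W → ω ∈ W) :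
    ∀ ω : Set ι, insert e ω ∈ W → ω ∉ W → ω ∪ ↑Q ∉ W := by
  induction Q using Finset.induction_on with
  | empty => intro ω _ hω; simpa using hω
  | insert f Q hfQ ih =>
    intro ω heω hω
    have h1 : ω ∪ ↑Q ∉ W := ih (fun g hg => hQ g (mem_insert_of_mem hg)) ω heω hω
    have h2 : insert e (ω ∪ ↑Q) ∈ W := hW (Set.insert_subset_insert Set.subset_union_left) heω
    have h3 : insert f (ω ∪ ↑Q) ∉ W := fun h => h1 (hQ f (mem_insert_self f Q) _ h2 h)
    rwa [coe_insert, Set.union_insert]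

omit [Fintype ι] in
/-- **Splitting lemma.**  If no coordinate of `P` has a substitute in `Q` for the increasing event `W`
(`insert e ω ∈ W → insert f ω ∈ W → ω ∈ W` for `e ∈ P`, `f ∈ Q`), then `ω ∪ P ∈ W` and `ω ∪ Q ∈ W` imply `ω ∈ W`. [this work] -/
theorem mem_of_union_mem_of_noEdge {W : Set (Set ι)} (hW : IsUpperSet W) (P Q : Finset ι)
    (hPQ : ∀ e ∈ P, ∀ f ∈ Q, ∀ ω : Set ι, insert e ω ∈ W → insert f ω ∈ W → ω ∈ W) :
    ∀ ω : Set ι, ω ∪ ↑P ∈ W → ω ∪ ↑Q ∈ W → ω ∈ W := by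
  induction P using Finset.induction_on with
  | empty => intro ω hP _; simpa using hP
  | insert e P heP ih =>
    intro ω hP hQ
    by_cases h0 : ω ∪ ↑P ∈ W
    · exact ih (fun e' he' => hPQ e' (mem_insert_of_mem he')) ω h0 hQ
    · exfalso
      have heω : insert e (ω ∪ ↑P) ∈ W := by rwa [coe_insert, Set.union_insert] at hP
      have hQ' : (ω ∪ ↑P) ∪ ↑Q ∈ W :=
        hW (Set.union_subset_union_left (↑Q : Set ι) (Set.subset_union_left : ω ⊆ ω ∪ ↑P)) hQ
      exact union_notMem_of_noEdge hW Q (hPQ e (mem_insert_self e P)) _ heω h0 hQ'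

omit [Fintype ι] in
/-- **A factorisation has no substitutes across its blocks**: if `W = U ∩ V` with `e` not acting on `V` and `f` not acting on `U`
(increasing events), then `insert e ω ∈ W → insert f ω ∈ W → ω ∈ W`. [this work] -/
theorem noEdge_of_inter {U V : Set (Set ι)} (hU : IsUpperSet U) (hV : IsUpperSet V) {e f : ι} (he : ¬ Affects V e)
    (hf : ¬ Affects U f) (ω : Set ι) (h1 : insert e ω ∈ U ∩ V) (h2 : insert f ω ∈ U ∩ V) : ω ∈ U ∩ V :=
  ⟨(insert_mem_iff_of_not_affects hU hf ω).1 h2.1, (insert_mem_iff_of_not_affects hV he ω).1 h1.2⟩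

/-! ### Products over pairwise disjoint supports -/

section Frame

variable {κ : Type*} (A : κ → Set (Set ι)) (J : Finset κ)

/-- The support of an intersection over a finite family lies in the union of the supports. [folklore] -/
theorem esupp_biInter_subset : esupp (⋂ j ∈ J, A j) ⊆ J.biUnion fun j => esupp (A j) := by
  induction J using Finset.induction_on with
  | empty =>
    intro e he
    have : (⋂ j ∈ (∅ : Finset κ), A j) = Set.univ := by simp
    rw [this] at he
    obtain ⟨ω, hω, -⟩ := mem_esupp.1 he
    exact absurd (Set.mem_univ ω) hω
  | insert j J hjJ ih =>
    intro e he
    rw [set_biInter_insert] at he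
    rw [biUnion_insert]
    rcases mem_union.1 (esupp_inter_subset _ _ he) with h | h
    · exact mem_union_left _ h
    · exact mem_union_right _ (ih h)

omit [Fintype ι] in
/-- A configuration covering the supports of all members lies in their intersection (nonempty increasing members). [folklore] -/
theorem mem_biInter_of_esupp_subset [Fintype ι] (hA : ∀ j ∈ J, IsUpperSet (A j)) (hne : ∀ j ∈ J, (A j).Nonempty) {ω : Set ι}
    (hω : ∀ j ∈ J, (↑(esupp (A j)) : Set ι) ⊆ ω) : ω ∈ ⋂ j ∈ J, A j := by
  simp only [Set.mem_iInter]
  exact fun j hj => mem_of_esupp_subset (hA j hj) (hne j hj) (hω j hj)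

/-- **Each factor's support lies in the support of the product** (nonempty increasing factors with pairwise disjoint supports).
[this work] -/
theorem subset_esupp_biInter_of_frame (hA : ∀ j ∈ J, IsUpperSet (A j)) (hne : ∀ j ∈ J, (A j).Nonempty)
    (hd : ∀ j ∈ J, ∀ j' ∈ J, j ≠ j' → Disjoint (esupp (A j)) (esupp (A j'))) {j : κ} (hj : j ∈ J) :
    esupp (A j) ⊆ esupp (⋂ l ∈ J, A l) := by
  intro e he
  obtain ⟨ω, hω, heω⟩ := mem_esupp.1 he
  -- open all the other blocks
  set T : Set ι := ↑((J.erase j).biUnion fun l => esupp (A l)) with hT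
  have hTj : Disjoint T ↑(esupp (A j)) := by
    rw [hT, Set.disjoint_left]
    intro i hi hij
    rw [mem_coe, mem_biUnion] at hi
    obtain ⟨l, hl, hil⟩ := hi
    exact Finset.disjoint_left.1 (hd l (mem_of_mem_erase hl) j hj (ne_of_mem_erase hl)) hil (mem_coe.1 hij)
  have key : ∀ η : Set ι, (η ∪ T) ∩ ↑(esupp (A j)) = η ∩ ↑(esupp (A j)) := by
    intro η; ext i
    simp only [Set.mem_inter_iff, Set.mem_union]
    constructor
    · rintro ⟨hi | hi, hij⟩
      · exact ⟨hi, hij⟩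
      · exact absurd hij (Set.disjoint_left.1 hTj hi)
    · rintro ⟨hi, hij⟩; exact ⟨Or.inl hi, hij⟩
  refine mem_esupp.2 ⟨ω ∪ T, fun h => hω ?_, ?_⟩
  · have h' : ω ∪ T ∈ A j := (Set.mem_iInter₂.1 h) j hj
    exact (mem_iff_of_inter_esupp_eq (hA j hj) (key ω)).1 h'
  · rw [← Set.insert_union]
    refine Set.mem_iInter₂.2 fun l hl => ?_
    by_cases hlj : l = j
    · subst hlj
      exact (mem_iff_of_inter_esupp_eq (hA l hl) (key (insert e ω))).2 heω
    · refine mem_of_esupp_subset (hA l hl) (hne l hl) ?_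
      intro i hi
      refine Set.mem_union_right _ ?_
      rw [hT, mem_coe, mem_biUnion]
      exact ⟨l, mem_erase.2 ⟨hlj, hl⟩, hi⟩

/-- **Saturating the other blocks recovers a factor**: `hull (⋃_{l ≠ j} esupp A_l) (⋂_l A_l) = A_j`
(nonempty increasing factors, pairwise disjoint supports). [this work] -/
theorem hull_biInter_of_frame (hA : ∀ j ∈ J, IsUpperSet (A j)) (hne : ∀ j ∈ J, (A j).Nonempty)
    (hd : ∀ j ∈ J, ∀ j' ∈ J, j ≠ j' → Disjoint (esupp (A j)) (esupp (A j'))) {j : κ} (hj : j ∈ J) :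
    hull ↑((J.erase j).biUnion fun l => esupp (A l)) (⋂ l ∈ J, A l) = A j := by
  set T : Set ι := ↑((J.erase j).biUnion fun l => esupp (A l)) with hT
  ext ω
  simp only [mem_hull, Set.mem_iInter]
  constructor
  · intro h
    have hTj : Disjoint T ↑(esupp (A j)) := by
      rw [hT, Set.disjoint_left]
      intro i hi hij
      rw [mem_coe, mem_biUnion] at hi
      obtain ⟨l, hl, hil⟩ := hi
      exact Finset.disjoint_left.1 (hd l (mem_of_mem_erase hl) j hj (ne_of_mem_erase hl)) hil (mem_coe.1 hij)
    have e : hull T (A j) = A j := hull_eq_self_of_disjoint (hA j hj) hTj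
    have : ω ∈ hull T (A j) := h j hj
    rwa [e] at this
  · intro h l hl
    by_cases hlj : l = j
    · subst hlj; exact hA l hl Set.subset_union_left h
    · refine mem_of_esupp_subset (hA l hl) (hne l hl) fun i hi => Set.mem_union_right _ ?_
      rw [hT, mem_coe, mem_biUnion]
      exact ⟨l, mem_erase.2 ⟨hlj, hl⟩, hi⟩

end Frame

/-! ### Rigidity of two factorisations -/

section TwoFactorisations

variable {κ κ' : Type*}

/-- **Two factorisations meet only trivially across blocks.**  Let the increasing event `W` be the intersection of nonempty
increasing events `A_j` (`j ∈ J`) with pairwise disjoint supports, and also of increasing events `B_k` (`k ∈ K`) with pairwise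
disjoint supports.
If the blocks `esupp (A a)` and `esupp (B b)` meet in a nonempty set `P`, then the configuration `Pᶜ` ("everything but `P`") is NOT
in `W`.  (So on `P` the event `W` has a genuine factor; the finest factorisation refines both.) [this work] -/
theorem compl_notMem_of_two_factorisations (A : κ → Set (Set ι)) (J : Finset κ) (B : κ' → Set (Set ι)) (K : Finset κ')
    (hA : ∀ j ∈ J, IsUpperSet (A j)) (hAne : ∀ j ∈ J, (A j).Nonempty)
    (hAd : ∀ j ∈ J, ∀ j' ∈ J, j ≠ j' → Disjoint (esupp (A j)) (esupp (A j')))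
    (hB : ∀ k ∈ K, IsUpperSet (B k))
    (hBd : ∀ k ∈ K, ∀ k' ∈ K, k ≠ k' → Disjoint (esupp (B k)) (esupp (B k')))
    (hAB : (⋂ j ∈ J, A j) = ⋂ k ∈ K, B k) {a : κ} (ha : a ∈ J) {b : κ'} (hb : b ∈ K)
    (hP : (esupp (A a) ∩ esupp (B b)).Nonempty) :
    (↑(esupp (A a) ∩ esupp (B b)) : Set ι)ᶜ ∉ ⋂ j ∈ J, A j := by
  set W : Set (Set ι) := ⋂ j ∈ J, A j with hWdef
  set P : Finset ι := esupp (A a) ∩ esupp (B b) with hPdef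
  have hW : IsUpperSet W := isUpperSet_iInter fun j => isUpperSet_iInter fun hj => hA j hj
  -- the two factorisations `W = A_a ∩ (⋂_{j ≠ a} A_j) = B_b ∩ (⋂_{k ≠ b} B_k)`
  have splitA : W = A a ∩ ⋂ j ∈ J.erase a, A j := by
    rw [hWdef, ← Finset.insert_erase ha, set_biInter_insert, Finset.insert_erase ha]
  have splitB : W = B b ∩ ⋂ k ∈ K.erase b, B k := by
    rw [hAB, ← Finset.insert_erase hb, set_biInter_insert, Finset.insert_erase hb]
  have hRA : IsUpperSet (⋂ j ∈ J.erase a, A j) := isUpperSet_iInter fun j => isUpperSet_iInter fun hj => hA j (mem_of_mem_erase hj)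
  have hRB : IsUpperSet (⋂ k ∈ K.erase b, B k) := isUpperSet_iInter fun k => isUpperSet_iInter fun hk => hB k (mem_of_mem_erase hk)
  -- a coordinate of the block of `A a` does not act on the other `A`-factors (and similarly for `B`)
  have notA : ∀ e ∈ esupp (A a), ¬ Affects (⋂ j ∈ J.erase a, A j) e := by
    intro e he hAff
    have := esupp_biInter_subset A (J.erase a) (mem_esupp.2 hAff)
    rw [mem_biUnion] at this
    obtain ⟨l, hl, hel⟩ := this
    exact Finset.disjoint_left.1 (hAd a ha l (mem_of_mem_erase hl) (ne_of_mem_erase hl).symm) he hel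
  have notB : ∀ e ∈ esupp (B b), ¬ Affects (⋂ k ∈ K.erase b, B k) e := by
    intro e he hAff
    have := esupp_biInter_subset B (K.erase b) (mem_esupp.2 hAff)
    rw [mem_biUnion] at this
    obtain ⟨l, hl, hel⟩ := this
    exact Finset.disjoint_left.1 (hBd b hb l (mem_of_mem_erase hl) (ne_of_mem_erase hl).symm) he hel
  -- no substitutes across `P | Pᶜ`
  have noEdge : ∀ e ∈ P, ∀ f ∈ (univ : Finset ι) \ P, ∀ ω : Set ι, insert e ω ∈ W → insert f ω ∈ W → ω ∈ W := by
    intro e he f hf ω h1 h2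
    rw [hPdef, mem_inter] at he
    have hf' : f ∉ esupp (A a) ∨ f ∉ esupp (B b) := by
      by_cases hfa : f ∈ esupp (A a)
      · exact Or.inr fun hfb => (mem_sdiff.1 hf).2 (mem_inter.2 ⟨hfa, hfb⟩)
      · exact Or.inl hfa
    rcases hf' with hfa | hfb
    · rw [splitA] at h1 h2 ⊢
      exact noEdge_of_inter (hA a ha) hRA (notA e he.1) (fun h => hfa (mem_esupp.2 h)) ω h1 h2
    · rw [splitB] at h1 h2 ⊢
      exact noEdge_of_inter (hB b hb) hRB (notB e he.2) (fun h => hfb (mem_esupp.2 h)) ω h1 h2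
  -- if `Pᶜ ∈ W` then every `ω` with `ω ∪ P ∈ W` is in `W`, i.e. no coordinate of `P` acts on `W`
  intro hcompl
  have hullP : ∀ ω : Set ι, ω ∪ ↑P ∈ W → ω ∈ W := by
    intro ω hω
    refine mem_of_union_mem_of_noEdge hW P (univ \ P) noEdge ω hω ?_
    refine hW ?_ hcompl
    intro i hi
    refine Set.mem_union_right _ ?_
    rw [coe_sdiff, coe_univ]
    exact ⟨Set.mem_univ i, hi⟩
  obtain ⟨e, he⟩ := hP
  have heW : e ∈ esupp W := subset_esupp_biInter_of_frame A J hA hAne hAd ha (mem_of_mem_inter_left he)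
  obtain ⟨ω, hω, heω⟩ := mem_esupp.1 heW
  apply hω
  apply hullP
  refine hW ?_ heω
  intro i hi
  rcases Set.mem_insert_iff.1 hi with rfl | hi
  · exact Set.mem_union_right _ (mem_coe.2 he)
  · exact Set.mem_union_left _ hi

end TwoFactorisations

end Summit.CriticalPhenomena.PercolationContinuityZ3.Theorems
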